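import Summits.BirchSwinnertonDyer.BirchSwinnertonDyer.Theorems.ManinLocalTwoThreeEtaBasisFortyFiveB
import Literature.NumberTheory.EllipticCurves.ModularFormsGamma0WeightTwoDimension
import HarnessLib

/-!
# Level 45 (C3 domain, genus 3), part 3: `dim M₂(Γ₀(45)) = 10`, the ten-form family `B1, …, B10` and its coefficient columns

Cell `bsd-f2-manin`, route `ManinLocalTwoThree`, crux C3 `ManinPrimeToThreeAtNine` (stmt-BirchSwinnertonDyer-22968: `3² ∣ 45`), prover seat p2 gen 28;
`--supports` (helper).  Inputs: `dim M₂(Γ₀(N)) = g + ν_∞ − 1` (`Literature…ModularFormsGamma0WeightTwoDimension`, LEAD p1) and the ten holomorphic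
`η`-quotients `B1, …, B10` with their certified `q`-coefficients (`…EtaBasisFortyFiveA/B`).

* §1 `finrank_modularForm_two_fortyFive : dim M₂(Γ₀(45)) = 10` (`μ = 72`, `ν_∞ = 8`, `ν₂ = ν₃ = 0`, `g = 3`);
* §2 the family `basisForms : Fin 10 → M₂(Γ₀(45))`, the coefficient functional on combinations (`coeff_sum_smul`), and the fourteen needed
  coefficient values of each form (`cols_Bk`, `n ∈ {0,…,6,8,9,10,15,16,20,25}`).

Part 4 (`…BasisSolveFortyFive`) does the `10 × 10` pivot solve (pivots `1,2,3,4,5,6,8,9,10,15`), independence and coordinates; part 5 the curve-side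
exclusion; part 6 the pinning `⇑D.f = ⇑Φ₄₅`.  Nothing here proves C3, Manin's conjecture or BSD.
[cite: DiamondShurman2005, Thm. 3.5.1, §3.9] [cite: Ligozat1975, Ch. 3]
-/

set_option autoImplicit false
-- lint-debt: the directory name repeats the summit name (sibling precedent `ManinLocalTwoThreeBasisFortyFour.lean`)
set_option linter.dupNamespace false

noncomputable section

open Complex Polynomial
open UpperHalfPlane hiding I
open scoped MatrixGroups ModularForm
open CongruenceSubgroup
open Literature.NumberTheory.ModularForms
open Literature.NumberTheory.EllipticCurves Literature.NumberTheory.EllipticCurves.ModularForms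

namespace Summit.BirchSwinnertonDyer.BirchSwinnertonDyer.Theorems.ManinLocalTwoThree.LevelFortyFive

/-! ## §1 `dim M₂(Γ₀(45)) = 10` -/

/-- `μ(Γ₀(45)) = 72`, `ν_∞ = 8`, `ν₂ = ν₃ = 0`. [cite: DiamondShurman2005, §3.8] -/
theorem gamma0_data_45 : gamma0Index 45 = 72 ∧ nuInfty 45 = 8 ∧ nu₂ 45 = 0 ∧ nu₃ 45 = 0 :=
  ⟨(gamma0Index_mul (m := 9) (n := 5) (by norm_num)).trans
      (by rw [show (9 : ℕ) = 3 ^ 2 by norm_num, gamma0Index_prime_pow (p := 3) (e := 2) Nat.prime_three (by norm_num),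
        gamma0Index_prime (by norm_num : Nat.Prime 5)]; norm_num),
    by decide, by rw [nu₂_eq_card]; decide, by rw [nu₃_eq_card]; decide⟩

/-- `g(X₀(45)) = 3`. [cite: DiamondShurman2005, Thm. 3.1.1] -/
theorem genusX0_fortyFive : genusX0 45 = 3 := by
  obtain ⟨h1, h2, h3, h4⟩ := gamma0_data_45
  rw [genusX0, h1, h2, h3, h4]

/-- **`dim M₂(Γ₀(45)) = 10`** (`= g + ν_∞ − 1`). [cite: DiamondShurman2005, Thm. 3.5.1] -/
theorem finrank_modularForm_two_fortyFive : Module.finrank ℂ (ModularForm (Gamma0 45) 2) = 10 := by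
  rw [finrank_modularForm_two_eq 45, genusX0_fortyFive, gamma0_data_45.2.1]

/-! ## §2 The ten forms, the coefficient functional, the columns -/

/-- The ten holomorphic `η`-quotients `(B1, …, B10)` of `M₂(Γ₀(45))`. [folklore] -/
def basisForms : Fin 10 → ModularForm (Gamma0 45) 2 := ![B1, B2, B3, B4, B5, B6, B7, B8, B9, B10]

/-- `q`-coefficients of a finite combination in `M₂(Γ₀(45))`. [folklore] -/
theorem coeff_sum_smul (c : Fin 10 → ℂ) (v : Fin 10 → ModularForm (Gamma0 45) 2) (n : ℕ) :
    (qExpansion 1 ⇑(∑ i, c i • v i)).coeff n = ∑ i, c i * (qExpansion 1 ⇑(v i)).coeff n := by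
  have h1 : qExpansion 1 ⇑(∑ i, c i • v i) = ∑ i, c i • qExpansion 1 ⇑(v i) := by
    change ModularForm.qExpansionAddHom one_pos one_mem_strictPeriods_Gamma0 2 (∑ i, c i • v i) = _
    rw [map_sum]
    refine Finset.sum_congr rfl fun i _ ↦ ?_
    change qExpansion 1 ⇑(c i • v i) = _
    exact ModularForm.qExpansion_smul one_pos one_mem_strictPeriods_Gamma0 (c i) (v i)
  rw [h1, map_sum]
  simp only [map_smul, smul_eq_mul]

/-- `succ^1 0 = 1` in `Fin 10` (normalisation after `Fin.sum_univ_succ`). [folklore] -/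
theorem finSucc1 : ((0 : Fin 9).succ : Fin 10) = 1 := by decide

/-- `succ^2 0 = 2` in `Fin 10` (normalisation after `Fin.sum_univ_succ`). [folklore] -/
theorem finSucc2 : ((0 : Fin 8).succ.succ : Fin 10) = 2 := by decide

/-- `succ^3 0 = 3` in `Fin 10` (normalisation after `Fin.sum_univ_succ`). [folklore] -/
theorem finSucc3 : ((0 : Fin 7).succ.succ.succ : Fin 10) = 3 := by decide

/-- `succ^4 0 = 4` in `Fin 10` (normalisation after `Fin.sum_univ_succ`). [folklore] -/
theorem finSucc4 : ((0 : Fin 6).succ.succ.succ.succ : Fin 10) = 4 := by decide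

/-- `succ^5 0 = 5` in `Fin 10` (normalisation after `Fin.sum_univ_succ`). [folklore] -/
theorem finSucc5 : ((0 : Fin 5).succ.succ.succ.succ.succ : Fin 10) = 5 := by decide

/-- `succ^6 0 = 6` in `Fin 10` (normalisation after `Fin.sum_univ_succ`). [folklore] -/
theorem finSucc6 : ((0 : Fin 4).succ.succ.succ.succ.succ.succ : Fin 10) = 6 := by decide

/-- `succ^7 0 = 7` in `Fin 10` (normalisation after `Fin.sum_univ_succ`). [folklore] -/
theorem finSucc7 : ((0 : Fin 3).succ.succ.succ.succ.succ.succ.succ : Fin 10) = 7 := by decide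

/-- `succ^8 0 = 8` in `Fin 10` (normalisation after `Fin.sum_univ_succ`). [folklore] -/
theorem finSucc8 : ((0 : Fin 2).succ.succ.succ.succ.succ.succ.succ.succ : Fin 10) = 8 := by decide

/-- `succ^9 0 = 9` in `Fin 10` (normalisation after `Fin.sum_univ_succ`). [folklore] -/
theorem finSucc9 : ((0 : Fin 1).succ.succ.succ.succ.succ.succ.succ.succ.succ : Fin 10) = 9 := by decide

/-- The fourteen needed `q`-coefficients of `B1`. [cite: Koehler2011, §2.1] -/
theorem cols_B1 :
    (qExpansion 1 ⇑(B1)).coeff 0 = (0 : ℂ) ∧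
    (qExpansion 1 ⇑(B1)).coeff 1 = (0 : ℂ) ∧
    (qExpansion 1 ⇑(B1)).coeff 2 = (0 : ℂ) ∧
    (qExpansion 1 ⇑(B1)).coeff 3 = (0 : ℂ) ∧
    (qExpansion 1 ⇑(B1)).coeff 4 = (0 : ℂ) ∧
    (qExpansion 1 ⇑(B1)).coeff 5 = (0 : ℂ) ∧
    (qExpansion 1 ⇑(B1)).coeff 6 = (0 : ℂ) ∧
    (qExpansion 1 ⇑(B1)).coeff 8 = (0 : ℂ) ∧
    (qExpansion 1 ⇑(B1)).coeff 9 = (0 : ℂ) ∧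
    (qExpansion 1 ⇑(B1)).coeff 10 = (1 : ℂ) ∧
    (qExpansion 1 ⇑(B1)).coeff 15 = (0 : ℂ) ∧
    (qExpansion 1 ⇑(B1)).coeff 16 = (0 : ℂ) ∧
    (qExpansion 1 ⇑(B1)).coeff 20 = (0 : ℂ) ∧
    (qExpansion 1 ⇑(B1)).coeff 25 = (2 : ℂ) := by
  refine ⟨?_, ?_, ?_, ?_, ?_, ?_, ?_, ?_, ?_, ?_, ?_, ?_, ?_, ?_⟩ <;> (rw [coeff_B1 _ (by norm_num)]; norm_num)

/-- The fourteen needed `q`-coefficients of `B2`. [cite: Koehler2011, §2.1] -/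
theorem cols_B2 :
    (qExpansion 1 ⇑(B2)).coeff 0 = (0 : ℂ) ∧
    (qExpansion 1 ⇑(B2)).coeff 1 = (0 : ℂ) ∧
    (qExpansion 1 ⇑(B2)).coeff 2 = (0 : ℂ) ∧
    (qExpansion 1 ⇑(B2)).coeff 3 = (0 : ℂ) ∧
    (qExpansion 1 ⇑(B2)).coeff 4 = (0 : ℂ) ∧
    (qExpansion 1 ⇑(B2)).coeff 5 = (0 : ℂ) ∧
    (qExpansion 1 ⇑(B2)).coeff 6 = (1 : ℂ) ∧
    (qExpansion 1 ⇑(B2)).coeff 8 = (0 : ℂ) ∧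
    (qExpansion 1 ⇑(B2)).coeff 9 = (1 : ℂ) ∧
    (qExpansion 1 ⇑(B2)).coeff 10 = (0 : ℂ) ∧
    (qExpansion 1 ⇑(B2)).coeff 15 = (0 : ℂ) ∧
    (qExpansion 1 ⇑(B2)).coeff 16 = (0 : ℂ) ∧
    (qExpansion 1 ⇑(B2)).coeff 20 = (0 : ℂ) ∧
    (qExpansion 1 ⇑(B2)).coeff 25 = (0 : ℂ) := by
  refine ⟨?_, ?_, ?_, ?_, ?_, ?_, ?_, ?_, ?_, ?_, ?_, ?_, ?_, ?_⟩ <;> (rw [coeff_B2 _ (by norm_num)]; norm_num)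

/-- The fourteen needed `q`-coefficients of `B3`. [cite: Koehler2011, §2.1] -/
theorem cols_B3 :
    (qExpansion 1 ⇑(B3)).coeff 0 = (0 : ℂ) ∧
    (qExpansion 1 ⇑(B3)).coeff 1 = (0 : ℂ) ∧
    (qExpansion 1 ⇑(B3)).coeff 2 = (1 : ℂ) ∧
    (qExpansion 1 ⇑(B3)).coeff 3 = (0 : ℂ) ∧
    (qExpansion 1 ⇑(B3)).coeff 4 = (0 : ℂ) ∧
    (qExpansion 1 ⇑(B3)).coeff 5 = (2 : ℂ) ∧
    (qExpansion 1 ⇑(B3)).coeff 6 = (0 : ℂ) ∧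
    (qExpansion 1 ⇑(B3)).coeff 8 = (5 : ℂ) ∧
    (qExpansion 1 ⇑(B3)).coeff 9 = (0 : ℂ) ∧
    (qExpansion 1 ⇑(B3)).coeff 10 = (0 : ℂ) ∧
    (qExpansion 1 ⇑(B3)).coeff 15 = (0 : ℂ) ∧
    (qExpansion 1 ⇑(B3)).coeff 16 = (0 : ℂ) ∧
    (qExpansion 1 ⇑(B3)).coeff 20 = (14 : ℂ) ∧
    (qExpansion 1 ⇑(B3)).coeff 25 = (0 : ℂ) := by
  refine ⟨?_, ?_, ?_, ?_, ?_, ?_, ?_, ?_, ?_, ?_, ?_, ?_, ?_, ?_⟩ <;> (rw [coeff_B3 _ (by norm_num)]; norm_num)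

/-- The fourteen needed `q`-coefficients of `B4`. [cite: Koehler2011, §2.1] -/
theorem cols_B4 :
    (qExpansion 1 ⇑(B4)).coeff 0 = (0 : ℂ) ∧
    (qExpansion 1 ⇑(B4)).coeff 1 = (0 : ℂ) ∧
    (qExpansion 1 ⇑(B4)).coeff 2 = (0 : ℂ) ∧
    (qExpansion 1 ⇑(B4)).coeff 3 = (0 : ℂ) ∧
    (qExpansion 1 ⇑(B4)).coeff 4 = (1 : ℂ) ∧
    (qExpansion 1 ⇑(B4)).coeff 5 = (0 : ℂ) ∧
    (qExpansion 1 ⇑(B4)).coeff 6 = (0 : ℂ) ∧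
    (qExpansion 1 ⇑(B4)).coeff 8 = (0 : ℂ) ∧
    (qExpansion 1 ⇑(B4)).coeff 9 = (0 : ℂ) ∧
    (qExpansion 1 ⇑(B4)).coeff 10 = (2 : ℂ) ∧
    (qExpansion 1 ⇑(B4)).coeff 15 = (0 : ℂ) ∧
    (qExpansion 1 ⇑(B4)).coeff 16 = (4 : ℂ) ∧
    (qExpansion 1 ⇑(B4)).coeff 20 = (0 : ℂ) ∧
    (qExpansion 1 ⇑(B4)).coeff 25 = (3 : ℂ) := by
  refine ⟨?_, ?_, ?_, ?_, ?_, ?_, ?_, ?_, ?_, ?_, ?_, ?_, ?_, ?_⟩ <;> (rw [coeff_B4 _ (by norm_num)]; norm_num)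

/-- The fourteen needed `q`-coefficients of `B5`. [cite: Koehler2011, §2.1] -/
theorem cols_B5 :
    (qExpansion 1 ⇑(B5)).coeff 0 = (1 : ℂ) ∧
    (qExpansion 1 ⇑(B5)).coeff 1 = (0 : ℂ) ∧
    (qExpansion 1 ⇑(B5)).coeff 2 = (0 : ℂ) ∧
    (qExpansion 1 ⇑(B5)).coeff 3 = (2 : ℂ) ∧
    (qExpansion 1 ⇑(B5)).coeff 4 = (0 : ℂ) ∧
    (qExpansion 1 ⇑(B5)).coeff 5 = (0 : ℂ) ∧
    (qExpansion 1 ⇑(B5)).coeff 6 = (5 : ℂ) ∧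
    (qExpansion 1 ⇑(B5)).coeff 8 = (0 : ℂ) ∧
    (qExpansion 1 ⇑(B5)).coeff 9 = (6 : ℂ) ∧
    (qExpansion 1 ⇑(B5)).coeff 10 = (0 : ℂ) ∧
    (qExpansion 1 ⇑(B5)).coeff 15 = (12 : ℂ) ∧
    (qExpansion 1 ⇑(B5)).coeff 16 = (0 : ℂ) ∧
    (qExpansion 1 ⇑(B5)).coeff 20 = (0 : ℂ) ∧
    (qExpansion 1 ⇑(B5)).coeff 25 = (0 : ℂ) := by
  refine ⟨?_, ?_, ?_, ?_, ?_, ?_, ?_, ?_, ?_, ?_, ?_, ?_, ?_, ?_⟩ <;> (rw [coeff_B5 _ (by norm_num)]; norm_num)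

/-- The fourteen needed `q`-coefficients of `B6`. [cite: Koehler2011, §2.1] -/
theorem cols_B6 :
    (qExpansion 1 ⇑(B6)).coeff 0 = (0 : ℂ) ∧
    (qExpansion 1 ⇑(B6)).coeff 1 = (0 : ℂ) ∧
    (qExpansion 1 ⇑(B6)).coeff 2 = (1 : ℂ) ∧
    (qExpansion 1 ⇑(B6)).coeff 3 = (1 : ℂ) ∧
    (qExpansion 1 ⇑(B6)).coeff 4 = (2 : ℂ) ∧
    (qExpansion 1 ⇑(B6)).coeff 5 = (3 : ℂ) ∧
    (qExpansion 1 ⇑(B6)).coeff 6 = (5 : ℂ) ∧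
    (qExpansion 1 ⇑(B6)).coeff 8 = (6 : ℂ) ∧
    (qExpansion 1 ⇑(B6)).coeff 9 = (5 : ℂ) ∧
    (qExpansion 1 ⇑(B6)).coeff 10 = (7 : ℂ) ∧
    (qExpansion 1 ⇑(B6)).coeff 15 = (1 : ℂ) ∧
    (qExpansion 1 ⇑(B6)).coeff 16 = (8 : ℂ) ∧
    (qExpansion 1 ⇑(B6)).coeff 20 = (20 : ℂ) ∧
    (qExpansion 1 ⇑(B6)).coeff 25 = (12 : ℂ) := by
  refine ⟨?_, ?_, ?_, ?_, ?_, ?_, ?_, ?_, ?_, ?_, ?_, ?_, ?_, ?_⟩ <;> (rw [coeff_B6 _ (by norm_num)]; norm_num)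

/-- The fourteen needed `q`-coefficients of `B7`. [cite: Koehler2011, §2.1] -/
theorem cols_B7 :
    (qExpansion 1 ⇑(B7)).coeff 0 = (1 : ℂ) ∧
    (qExpansion 1 ⇑(B7)).coeff 1 = (0 : ℂ) ∧
    (qExpansion 1 ⇑(B7)).coeff 2 = (0 : ℂ) ∧
    (qExpansion 1 ⇑(B7)).coeff 3 = (0 : ℂ) ∧
    (qExpansion 1 ⇑(B7)).coeff 4 = (0 : ℂ) ∧
    (qExpansion 1 ⇑(B7)).coeff 5 = (3 : ℂ) ∧
    (qExpansion 1 ⇑(B7)).coeff 6 = (0 : ℂ) ∧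
    (qExpansion 1 ⇑(B7)).coeff 8 = (0 : ℂ) ∧
    (qExpansion 1 ⇑(B7)).coeff 9 = (0 : ℂ) ∧
    (qExpansion 1 ⇑(B7)).coeff 10 = (9 : ℂ) ∧
    (qExpansion 1 ⇑(B7)).coeff 15 = (12 : ℂ) ∧
    (qExpansion 1 ⇑(B7)).coeff 16 = (0 : ℂ) ∧
    (qExpansion 1 ⇑(B7)).coeff 20 = (21 : ℂ) ∧
    (qExpansion 1 ⇑(B7)).coeff 25 = (18 : ℂ) := by
  refine ⟨?_, ?_, ?_, ?_, ?_, ?_, ?_, ?_, ?_, ?_, ?_, ?_, ?_, ?_⟩ <;> (rw [coeff_B7 _ (by norm_num)]; norm_num)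

/-- The fourteen needed `q`-coefficients of `B8`. [cite: Koehler2011, §2.1] -/
theorem cols_B8 :
    (qExpansion 1 ⇑(B8)).coeff 0 = (0 : ℂ) ∧
    (qExpansion 1 ⇑(B8)).coeff 1 = (0 : ℂ) ∧
    (qExpansion 1 ⇑(B8)).coeff 2 = (0 : ℂ) ∧
    (qExpansion 1 ⇑(B8)).coeff 3 = (0 : ℂ) ∧
    (qExpansion 1 ⇑(B8)).coeff 4 = (1 : ℂ) ∧
    (qExpansion 1 ⇑(B8)).coeff 5 = (1 : ℂ) ∧
    (qExpansion 1 ⇑(B8)).coeff 6 = (2 : ℂ) ∧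
    (qExpansion 1 ⇑(B8)).coeff 8 = (3 : ℂ) ∧
    (qExpansion 1 ⇑(B8)).coeff 9 = (1 : ℂ) ∧
    (qExpansion 1 ⇑(B8)).coeff 10 = (2 : ℂ) ∧
    (qExpansion 1 ⇑(B8)).coeff 15 = (2 : ℂ) ∧
    (qExpansion 1 ⇑(B8)).coeff 16 = (4 : ℂ) ∧
    (qExpansion 1 ⇑(B8)).coeff 20 = (4 : ℂ) ∧
    (qExpansion 1 ⇑(B8)).coeff 25 = (3 : ℂ) := by
  refine ⟨?_, ?_, ?_, ?_, ?_, ?_, ?_, ?_, ?_, ?_, ?_, ?_, ?_, ?_⟩ <;> (rw [coeff_B8 _ (by norm_num)]; norm_num)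

/-- The fourteen needed `q`-coefficients of `B9`. [cite: Koehler2011, §2.1] -/
theorem cols_B9 :
    (qExpansion 1 ⇑(B9)).coeff 0 = (1 : ℂ) ∧
    (qExpansion 1 ⇑(B9)).coeff 1 = (1 : ℂ) ∧
    (qExpansion 1 ⇑(B9)).coeff 2 = (2 : ℂ) ∧
    (qExpansion 1 ⇑(B9)).coeff 3 = (2 : ℂ) ∧
    (qExpansion 1 ⇑(B9)).coeff 4 = (4 : ℂ) ∧
    (qExpansion 1 ⇑(B9)).coeff 5 = (3 : ℂ) ∧
    (qExpansion 1 ⇑(B9)).coeff 6 = (5 : ℂ) ∧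
    (qExpansion 1 ⇑(B9)).coeff 8 = (9 : ℂ) ∧
    (qExpansion 1 ⇑(B9)).coeff 9 = (6 : ℂ) ∧
    (qExpansion 1 ⇑(B9)).coeff 10 = (9 : ℂ) ∧
    (qExpansion 1 ⇑(B9)).coeff 15 = (12 : ℂ) ∧
    (qExpansion 1 ⇑(B9)).coeff 16 = (19 : ℂ) ∧
    (qExpansion 1 ⇑(B9)).coeff 20 = (22 : ℂ) ∧
    (qExpansion 1 ⇑(B9)).coeff 25 = (16 : ℂ) := by
  refine ⟨?_, ?_, ?_, ?_, ?_, ?_, ?_, ?_, ?_, ?_, ?_, ?_, ?_, ?_⟩ <;> (rw [coeff_B9 _ (by norm_num)]; norm_num)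

/-- The fourteen needed `q`-coefficients of `B10`. [cite: Koehler2011, §2.1] -/
theorem cols_B10 :
    (qExpansion 1 ⇑(B10)).coeff 0 = (0 : ℂ) ∧
    (qExpansion 1 ⇑(B10)).coeff 1 = (0 : ℂ) ∧
    (qExpansion 1 ⇑(B10)).coeff 2 = (1 : ℂ) ∧
    (qExpansion 1 ⇑(B10)).coeff 3 = (1 : ℂ) ∧
    (qExpansion 1 ⇑(B10)).coeff 4 = (2 : ℂ) ∧
    (qExpansion 1 ⇑(B10)).coeff 5 = (0 : ℂ) ∧
    (qExpansion 1 ⇑(B10)).coeff 6 = (2 : ℂ) ∧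
    (qExpansion 1 ⇑(B10)).coeff 8 = (3 : ℂ) ∧
    (qExpansion 1 ⇑(B10)).coeff 9 = (2 : ℂ) ∧
    (qExpansion 1 ⇑(B10)).coeff 10 = (1 : ℂ) ∧
    (qExpansion 1 ⇑(B10)).coeff 15 = (1 : ℂ) ∧
    (qExpansion 1 ⇑(B10)).coeff 16 = (8 : ℂ) ∧
    (qExpansion 1 ⇑(B10)).coeff 20 = (2 : ℂ) ∧
    (qExpansion 1 ⇑(B10)).coeff 25 = (0 : ℂ) := by
  refine ⟨?_, ?_, ?_, ?_, ?_, ?_, ?_, ?_, ?_, ?_, ?_, ?_, ?_, ?_⟩ <;> (rw [coeff_B10 _ (by norm_num)]; norm_num)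

end Summit.BirchSwinnertonDyer.BirchSwinnertonDyer.Theorems.ManinLocalTwoThree.LevelFortyFive

end
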